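import Summits.NavierStokesRegularity.OSWSelfSimilar.SheetRSolutionOperator
import HarnessLib

/-!
# SHEET-ℝ frame: the similarity BACKBONE `B₀ = 1 + ½ξ∂ − ∂²` has a bounded inverse `L²_w → E` with norm `≤ 2` — UNCONDITIONALLY

HONEST FRAMING (cell ns-blowup GROUP B / zone Z3, cases Z3-SR-CERT / Z3-SR-SPEC; 1-D MODEL certificate frame (viscous gCLM/OSW sheet on the
line); not Euler/NS; «violates: none — MODEL»). Nothing here asserts that a profile exists.

`SheetRSolutionOperator.exists_solutionOperator` produces the bounded linear solution operator of `−∂² + d∂ + V` on the concrete Hilbert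
spaces `W L = L²_w`, `Esp L hL = E` GIVEN coercivity of the weak form on compactly supported tests (for the certificate's `B_λ` that is the
interval-arithmetic input (C1)).  For the pure backbone `B₀` (`d = ½ξ`, `V = 1`; the linear part of the vorticity-scaled Leray similarity
operator in one dimension) the coercivity is a THEOREM: the kernel identity `SheetLineBackbone.backbone_energy_identity`
(`∫(B₀δ)wδ = ∫(¾L² − 1 + ¼ξ²)δ² + ∫wδ′²`) read at the WEAK level on `H¹`-type compactly supported tests,

  `linForm L (ξ/2) 1 v v₁ v v₁ = ∫ w v₁² + ∫ (¾L² − 1 + ¼ξ²) v²`      (`linForm_backbone_eq`)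

(one absolutely-continuous integration by parts of `(2ξ + ½ξw)·(v²)′`; no second derivative needed), whence for `L² ≥ 2`
`‖v₁‖²_w + ¼‖v‖²_w ≤ linForm(v; v)` (`backbone_coercive`, `κ = 1`) and therefore, with NO hypothesis beyond `L² ≥ 2` (the frame has `L = 8`):
**there is a bounded linear `S : W L →L[ℝ] Esp L hL` solving the weak equation `B₀u = g` for every `g ∈ L²_w`, with `‖S g‖_E ≤ 2‖g‖_w`, and
energy-space weak solutions are unique** (`exists_backbone_solutionOperator`, `backbone_solution_unique`).  This is (C1)'s analytic skeleton made
kernel; the data-dependent part of (C1) (the potential `κ_λ − ¼ ≥ 0` built from `Ω̄`) stays the certificate's.  Pure calculus; no definition, no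
named fact. WHAT THIS IS NOT: not NS; no number of record moves.
-/

noncomputable section

namespace Summit.NavierStokesRegularity.OSWSelfSimilar
namespace SheetRBackboneSolutionOperator

open _root_.MeasureTheory _root_.Set _root_.Filter _root_.Real SheetRWeakProfilePV SheetRWeakToStrong SheetREnergyClass SheetRWeightedMeasure
  SheetRLinearisedTests SheetREnergySpace SheetRTestSpace SheetRLinearisedFormBounds SheetRSolutionOperator
open scoped Topology ENNReal

/-! ### §1 Integration by parts against `(v²)′` for an `H¹`-type compactly supported test -/

/-- **Weak integration by parts.** For `g ∈ C¹` and a test `(v, v₁)` (`v = ∫₀v₁` compactly supported, `v₁ ∈ L²`):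
`∫ g·v·v₁ = −½ ∫ g′·v²` (the absolutely continuous product rule for `v²`, `v′ = v₁` a.e.). [folklore] -/
theorem integral_mul_test_eq {g v v₁ : ℝ → ℝ} (hg : ContDiff ℝ 1 g) (hv : IsCompactTest v v₁) :
    ∫ y, g y * (v y * v₁ y) = -(1 / 2) * ∫ y, deriv g y * v y ^ 2 := by
  obtain ⟨hc, -, -, B, hB0, hB⟩ := basic_of_isCompactTest hv
  obtain ⟨R, hR⟩ := hv.support
  have hii : ∀ a b, IntervalIntegrable v₁ volume a b := intervalIntegrable_of_memLp_two hv.memLp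
  set R' : ℝ := |R| + 1 with hR'
  have hR'pos : 0 < R' := by positivity
  have hvan : ∀ x, R' ≤ |x| → v x = 0 ∧ v₁ x = 0 := fun x hx => hR x (by linarith [le_abs_self R])
  have hgc' : Continuous (deriv g) := hg.continuous_deriv le_rfl
  -- absolutely continuous data on `[-R', R']`
  have hvac : AbsolutelyContinuousOnInterval v (-R') R' := absolutelyContinuousOnInterval_of_primitive hv.primitive hii _ _
  have hv2ac : AbsolutelyContinuousOnInterval (v * v) (-R') R' := hvac.mul hvac
  have hgac : AbsolutelyContinuousOnInterval g (-R') R' := hg.contDiffOn.absolutelyContinuousOnInterval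
  have hibp := hgac.integral_mul_deriv_eq_deriv_mul hv2ac
  have hva : v (-R') = 0 := (hvan _ (by rw [abs_neg, abs_of_pos hR'pos])).1
  have hvb : v R' = 0 := (hvan _ (by rw [abs_of_pos hR'pos])).1
  simp only [Pi.mul_apply, hva, hvb, mul_zero, sub_zero, zero_sub] at hibp
  -- `deriv (v·v) = 2 v v₁` a.e.
  have hder : ∀ᵐ y : ℝ, HasDerivAt v (v₁ y) y := by
    filter_upwards [_root_.LocallyIntegrable.ae_hasDerivAt_integral (hv.memLp.locallyIntegrable one_le_two)] with y hy
    have e : v = fun x => v 0 + ∫ s in (0 : ℝ)..x, v₁ s := funext hv.primitive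
    rw [e]
    exact (hy 0).const_add _
  have hder2 : ∀ᵐ y : ℝ, deriv (v * v) y = 2 * (v y * v₁ y) := by
    filter_upwards [hder] with y hy
    rw [(hy.mul hy).deriv]; ring
  have hcongr : ∫ y in (-R')..R', g y * deriv (v * v) y = ∫ y in (-R')..R', 2 * (g y * (v y * v₁ y)) :=
    intervalIntegral.integral_congr_ae (hder2.mono fun y hy _ => by rw [hy]; ring)
  -- supports inside `Ioc (-R') R'`
  have hsupp1 : Function.support (fun y => 2 * (g y * (v y * v₁ y))) ⊆ Ioc (-R') R' := by
    intro y hy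
    rw [Function.mem_support] at hy
    by_contra hout
    apply hy
    have : R' ≤ |y| := by
      simp only [mem_Ioc, not_and_or, not_lt, not_le] at hout
      rcases hout with h | h
      · rw [abs_of_nonpos (by linarith)]; linarith
      · rw [abs_of_pos (by linarith)]; exact h.le
    rw [(hvan y this).1]; ring
  have hsupp2 : Function.support (fun y => deriv g y * (v y * v y)) ⊆ Ioc (-R') R' := by
    intro y hy
    rw [Function.mem_support] at hy
    by_contra hout
    apply hy
    have : R' ≤ |y| := by
      simp only [mem_Ioc, not_and_or, not_lt, not_le] at hout
      rcases hout with h | h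
      · rw [abs_of_nonpos (by linarith)]; linarith
      · rw [abs_of_pos (by linarith)]; exact h.le
    rw [(hvan y this).1]; ring
  have e1 : ∫ y, 2 * (g y * (v y * v₁ y)) = ∫ y in (-R')..R', 2 * (g y * (v y * v₁ y)) :=
    (intervalIntegral.integral_eq_integral_of_support_subset hsupp1).symm
  have e2 : ∫ y, deriv g y * (v y * v y) = ∫ y in (-R')..R', deriv g y * (v y * v y) :=
    (intervalIntegral.integral_eq_integral_of_support_subset hsupp2).symm
  have e3 : ∫ y, deriv g y * v y ^ 2 = ∫ y, deriv g y * (v y * v y) :=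
    integral_congr_ae (Eventually.of_forall fun y => by simp only [sq])
  have h2 : ∫ y, 2 * (g y * (v y * v₁ y)) = 2 * ∫ y, g y * (v y * v₁ y) := integral_const_mul _ _
  have hibp' : ∫ x in (-R')..R', deriv g x * (v x * v x) = -∫ x in (-R')..R', g x * deriv (v * v) x := by linarith [hibp]
  rw [e3, e2, hibp', hcongr, ← e1, h2]
  ring

/-! ### §2 The backbone weak form on the diagonal and its coercivity -/

/-- **The backbone energy identity at the weak level**: for a test `(v, v₁)`,
`linForm L (ξ/2) 1 v v₁ v v₁ = ∫ (L²+ξ²) v₁² + ∫ (¾L² − 1 + ¼ξ²) v²`. [folklore] -/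
theorem linForm_backbone_eq (L : ℝ) {v v₁ : ℝ → ℝ} (hv : IsCompactTest v v₁) :
    linForm L (fun ξ => ξ / 2) (fun _ => 1) v v₁ v v₁ =
      (∫ y, (L ^ 2 + y ^ 2) * v₁ y ^ 2) + ∫ y, (3 / 4 * L ^ 2 - 1 + y ^ 2 / 4) * v y ^ 2 := by
  obtain ⟨hc, -, -, B, hB0, hB⟩ := basic_of_isCompactTest hv
  obtain ⟨hwv, hwv₁⟩ := weighted_of_isCompactTest (L := L) hv
  obtain ⟨R, hR⟩ := hv.support
  -- the multiplier of the first-order part and its derivative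
  set gf : ℝ → ℝ := fun y => 2 * y + (L ^ 2 + y ^ 2) * (y / 2) with hgf
  have hgfC : ContDiff ℝ 1 gf := by
    rw [hgf]; fun_prop
  have hgfd : ∀ y, deriv gf y = 2 + (L ^ 2 + 3 * y ^ 2) / 2 := by
    intro y
    have h : HasDerivAt gf (2 * 1 + ((2 * y) * (y / 2) + (L ^ 2 + y ^ 2) * (1 / 2))) y := by
      rw [hgf]
      have h1 : HasDerivAt (fun y : ℝ => 2 * y) (2 * 1) y := (hasDerivAt_id y).const_mul 2
      have h2 : HasDerivAt (fun y : ℝ => L ^ 2 + y ^ 2) (2 * y) y := by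
        have := (hasDerivAt_pow 2 y).const_add (L ^ 2)
        simpa using this
      have h3 : HasDerivAt (fun y : ℝ => y / 2) (1 / 2) y := (hasDerivAt_id y).div_const 2
      exact h1.add (h2.mul h3)
    rw [h.deriv]; ring
  -- compact support ⇒ `gf·v` is in `L²`, so `gf·v·v₁` is integrable
  have hsupp : HasCompactSupport v := by
    refine HasCompactSupport.intro (isCompact_Icc : IsCompact (Icc (-|R|) |R|)) fun x hx => ?_
    have : R ≤ |x| := by
      have h1 : |R| < |x| := by
        by_contra hle
        exact hx (mem_Icc.2 (abs_le.1 (not_lt.1 hle)))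
      linarith [le_abs_self R]
    exact (hR x this).1
  have hgv2 : MemLp (fun y => gf y * v y) 2 volume :=
    (hgfC.continuous.mul hc).memLp_of_hasCompactSupport (hsupp.mul_left)
  have hT2 : Integrable fun y => gf y * (v y * v₁ y) := by
    have h := hgv2.integrable_mul hv.memLp
    refine h.congr (Eventually.of_forall fun y => ?_)
    simp only [Pi.mul_apply]; ring
  -- split the diagonal integrand
  have hsplit : linForm L (fun ξ => ξ / 2) (fun _ => 1) v v₁ v v₁ =
      (∫ y, (L ^ 2 + y ^ 2) * v₁ y ^ 2) + (∫ y, gf y * (v y * v₁ y)) + ∫ y, (L ^ 2 + y ^ 2) * v y ^ 2 := by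
    have h12 : Integrable fun y => (L ^ 2 + y ^ 2) * v₁ y ^ 2 + gf y * (v y * v₁ y) := hwv₁.add hT2
    unfold linForm
    rw [← integral_add hwv₁ hT2, ← integral_add h12 hwv]
    refine integral_congr_ae (Eventually.of_forall fun y => ?_)
    simp only [hgf]
    ring
  rw [hsplit, integral_mul_test_eq hgfC hv]
  simp only [hgfd]
  -- `∫ w v² − ½∫ (2 + (L²+3ξ²)/2) v² = ∫ (¾L² − 1 + ¼ξ²) v²`
  have hI : Integrable fun y => (2 + (L ^ 2 + 3 * y ^ 2) / 2) * v y ^ 2 := by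
    have := (hwv.const_mul (3 / 2)).add ((hc.memLp_of_hasCompactSupport (μ := volume) hsupp).integrable_sq.const_mul (2 - L ^ 2))
    refine this.congr (Eventually.of_forall fun y => ?_)
    simp only [Pi.add_apply]; ring
  have e : -(1 / 2) * (∫ y, (2 + (L ^ 2 + 3 * y ^ 2) / 2) * v y ^ 2) + ∫ y, (L ^ 2 + y ^ 2) * v y ^ 2 =
      ∫ y, (3 / 4 * L ^ 2 - 1 + y ^ 2 / 4) * v y ^ 2 := by
    rw [← integral_const_mul, ← integral_add (hI.const_mul _) hwv]
    refine integral_congr_ae (Eventually.of_forall fun y => ?_)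
    ring
  rw [add_assoc, e]

/-- **Backbone coercivity on compactly supported tests** (`L² ≥ 2`): `‖v₁‖²_w + ¼‖v‖²_w ≤ linForm(v; v)` for `d = ½ξ`, `V = 1` — the weak
form of `B₀ = 1 + ½ξ∂ − ∂²` is `1`-coercive in the energy norm (the frame's `c_λ` skeleton; equality of the `ξ²/4` terms, slack `(½L² − 1)‖v‖²₂`). [folklore] -/
theorem backbone_coercive {L : ℝ} (hL2 : 2 ≤ L ^ 2) {v v₁ : ℝ → ℝ} (hv : IsCompactTest v v₁) :
    1 * ((∫ ξ, (L ^ 2 + ξ ^ 2) * v₁ ξ ^ 2) + 1 / 4 * ∫ ξ, (L ^ 2 + ξ ^ 2) * v ξ ^ 2) ≤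
      linForm L (fun ξ => ξ / 2) (fun _ => 1) v v₁ v v₁ := by
  rw [linForm_backbone_eq L hv, one_mul]
  obtain ⟨hc, -, -, -⟩ := basic_of_isCompactTest hv
  obtain ⟨hwv, -⟩ := weighted_of_isCompactTest (L := L) hv
  have hv2 : Integrable fun y => v y ^ 2 := by
    refine (hwv.div_const (L ^ 2)).mono' (hc.aestronglyMeasurable.pow 2) (Eventually.of_forall fun y => ?_)
    rw [Real.norm_eq_abs, abs_of_nonneg (sq_nonneg _), le_div_iff₀ (by linarith)]
    nlinarith [sq_nonneg (v y), sq_nonneg y, mul_nonneg (sq_nonneg y) (sq_nonneg (v y))]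
  have hI : Integrable fun y => (3 / 4 * L ^ 2 - 1 + y ^ 2 / 4) * v y ^ 2 := by
    have := (hwv.div_const 4).add (hv2.const_mul (L ^ 2 / 2 - 1))
    refine this.congr (Eventually.of_forall fun y => ?_)
    simp only [Pi.add_apply]; ring
  have e : (∫ y, (3 / 4 * L ^ 2 - 1 + y ^ 2 / 4) * v y ^ 2) - 1 / 4 * ∫ ξ, (L ^ 2 + ξ ^ 2) * v ξ ^ 2 =
      ∫ y, (L ^ 2 / 2 - 1) * v y ^ 2 := by
    rw [← integral_const_mul, ← integral_sub hI (hwv.const_mul _)]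
    refine integral_congr_ae (Eventually.of_forall fun y => ?_)
    ring
  have hnn : 0 ≤ ∫ y, (L ^ 2 / 2 - 1) * v y ^ 2 := integral_nonneg fun y => by
    have : 0 ≤ L ^ 2 / 2 - 1 := by linarith
    positivity
  linarith

/-! ### §3 The backbone's bounded inverse, unconditionally -/

/-- **The similarity backbone is boundedly invertible `L²_w → E`, unconditionally** (`L > 0`, `L² ≥ 2`; the frame's `L = 8`): there is a bounded
LINEAR `S : W L →L[ℝ] Esp L hL` such that for every `g ∈ L²_w` the profile `u = prim (der (S g))` solves the weak equation of
`u + ½ξu′ − u″ = g` against every compactly supported odd energy-class test, with `‖S g‖_E ≤ 2‖g‖_w`. [folklore] -/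
theorem exists_backbone_solutionOperator {L : ℝ} (hL : 0 < L) (hL2 : 2 ≤ L ^ 2) :
    ∃ S : W L →L[ℝ] Esp L hL,
      (∀ (g : W L) (v v₁ : ℝ → ℝ), IsCompactTest v v₁ →
        linForm L (fun ξ => ξ / 2) (fun _ => 1) (prim (der (S g))) (der (S g)) v v₁ = ∫ y, (L ^ 2 + y ^ 2) * ((g : ℝ → ℝ) y * v y)) ∧
      ∀ g : W L, ‖S g‖ ≤ 2 * ‖g‖ := by
  have hd : ∀ ξ : ℝ, |ξ / 2| ≤ 0 + 1 / 2 * |ξ| := fun ξ => by rw [abs_div, abs_two]; linarith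
  have hV : ∀ ξ : ℝ, |(fun _ : ℝ => (1 : ℝ)) ξ| ≤ 1 := fun ξ => by simp
  obtain ⟨S, hS, hSn⟩ := exists_solutionOperator (d := fun ξ => ξ / 2) (V := fun _ => 1) hL (by fun_prop) (by fun_prop)
    (by norm_num : (0 : ℝ) ≤ 1 / 2) hd hV one_pos (fun v v₁ hv => backbone_coercive hL2 hv)
  exact ⟨S, hS, fun g => by simpa using hSn g⟩

/-- **Uniqueness for the backbone**: two energy-space weak solutions of `B₀u = g` (same right-hand side on all compactly supported tests)
coincide (`L > 0`, `L² ≥ 2`). [folklore] -/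
theorem backbone_solution_unique {L : ℝ} (hL : 0 < L) (hL2 : 2 ≤ L ^ 2) {rhs : (ℝ → ℝ) → (ℝ → ℝ) → ℝ} {p q : Esp L hL}
    (hp : ∀ v v₁ : ℝ → ℝ, IsCompactTest v v₁ →
      linForm L (fun ξ => ξ / 2) (fun _ => 1) (prim (der p)) (der p) v v₁ = rhs v v₁)
    (hq : ∀ v v₁ : ℝ → ℝ, IsCompactTest v v₁ →
      linForm L (fun ξ => ξ / 2) (fun _ => 1) (prim (der q)) (der q) v v₁ = rhs v v₁) : p = q := by
  have hd : ∀ ξ : ℝ, |ξ / 2| ≤ 0 + 1 / 2 * |ξ| := fun ξ => by rw [abs_div, abs_two]; linarith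
  have hV : ∀ ξ : ℝ, |(fun _ : ℝ => (1 : ℝ)) ξ| ≤ 1 := fun ξ => by simp
  exact solution_unique (d := fun ξ => ξ / 2) (V := fun _ => 1) hL (by fun_prop) (by fun_prop) le_rfl
    (by norm_num : (0 : ℝ) ≤ 1 / 2) hd hV one_pos (fun v v₁ hv => backbone_coercive hL2 hv) hp hq

end SheetRBackboneSolutionOperator
end Summit.NavierStokesRegularity.OSWSelfSimilar

end
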